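import Summits.Ventures.Crystal3D.Theorems.StickyWulffConstantPolycrystalWulffBoundGenericShift
import Summits.Ventures.Crystal3D.Theorems.StickyWulffConstantPolycrystalWulffBoundTwinSectionShiftHolds
import Summits.Ventures.Crystal3D.Theorems.StickyWulffConstantPolycrystalWulffBoundSameLattice

/-!
# `PolycrystalWulffBound`, line `PolyDensity`: the per-edge CAP SHIFTS of the gap-sorted tree, in the
# exact form of `rung_gapTree`'s hypothesis `hshift` (crux `stmt-Ventures-19482`)

Route `StickyWulffConstant` of the venture `Summits/Ventures/Crystal3D`, second prover lane (poly-p2,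
gen 14).  `rung_gapTree` (…RungGapTree.lean) asks, for each tree edge with parent frame `P`, child frame
`C`, unit wall normal `n` and gap `θ`, for `∀ s, |W(P) ∩ {s + θ < ⟪y, n⟫}| ≤ |W(C) ∩ {s < ⟪y, n⟫}|`.
This file supplies it BY NAME for every wall type of the crux's law:
* `capShift_zero_of_image_eq` — equal lattices (`P''Λ = C''Λ`): `θ = 0`;
* `capShift_zero_of_perp` — co-axial pair about an axis `m'` with `⟪n, m'⟫ = 0` (VERTICAL twin wall,
  and every plane containing the twin axis): `θ = 0` (`volume_cruxWulffBody_inter_eq_of_perp`);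
* `capShift_of_coaxial` — ANY co-axial pair (`Ax m' P C`), any `n`: `θ = (1/√6)·√(1 − ⟪n, m'⟫²)`
  (`cruxWulffBody_twin_cdf_le`, i.e. `TwinSectionShift (1/√6)`, read for caps via `n ↦ −n`); basal
  walls (`n = ±m'`) get `θ = 0` from this too;
* two ARBITRARY frames: `θ = 1` — use `cruxWulffBody_cap_shift_one` (…GenericShift.lean) directly.
All constants are at most the crux's wall densities (`0`, `½·sin∠`, `½·sin∠`, `1`).
WHAT THIS IS NOT: new geometry; the crux is not claimed.
-/

noncomputable section

open scoped BigOperators InnerProductSpace ENNReal Pointwise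
open MeasureTheory Set

namespace Summit.Ventures.Crystal3D.Theorems

open Summit.Ventures.Crystal3D.Cruxes.TextureLiminf.TexShadow (E3)
open Literature.MathematicalPhysics.StatisticalMechanics (fccStacking barlowStacking IsHaggSeq)

/-- The crux's pair clause `Ax m A B` is symmetric in the two frames. -/
theorem cruxAx_symm {m : E3} {A B : E3 ≃ₗᵢ[ℝ] E3}
    (h : ∃ (L : E3 ≃ₗᵢ[ℝ] E3) (s₁ s₂ : E3) (σ σ' : ℤ → ℤ), IsHaggSeq σ ∧ IsHaggSeq σ' ∧
      L (EuclideanSpace.single (2 : Fin 3) (1 : ℝ)) = m ∧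
      A '' fccStacking 1 (Real.sqrt (2 / 3)) ⊆
        (fun q => L q + s₁) '' barlowStacking 1 (Real.sqrt (2 / 3)) σ ∧
      B '' fccStacking 1 (Real.sqrt (2 / 3)) ⊆
        (fun q => L q + s₂) '' barlowStacking 1 (Real.sqrt (2 / 3)) σ') :
    ∃ (L : E3 ≃ₗᵢ[ℝ] E3) (s₁ s₂ : E3) (σ σ' : ℤ → ℤ), IsHaggSeq σ ∧ IsHaggSeq σ' ∧
      L (EuclideanSpace.single (2 : Fin 3) (1 : ℝ)) = m ∧
      B '' fccStacking 1 (Real.sqrt (2 / 3)) ⊆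
        (fun q => L q + s₁) '' barlowStacking 1 (Real.sqrt (2 / 3)) σ ∧
      A '' fccStacking 1 (Real.sqrt (2 / 3)) ⊆
        (fun q => L q + s₂) '' barlowStacking 1 (Real.sqrt (2 / 3)) σ' := by
  obtain ⟨L, s₁, s₂, σ, σ', hσ, hσ', hL, hA, hB⟩ := h
  exact ⟨L, s₂, s₁, σ', σ, hσ', hσ, hL, hB, hA⟩

/-- **Cap shift across ANY co-axial wall** (parent `P`, child `C`, `Ax m' P C`, unit normal `n`):
gap `θ = (1/√6)·√(1 − ⟪n, m'⟫²)` — the inclined-twin charge, `≤ ½·sin∠(n, m')`. -/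
theorem capShift_of_coaxial {m' n : E3} {P C : E3 ≃ₗᵢ[ℝ] E3}
    (h : ∃ (L : E3 ≃ₗᵢ[ℝ] E3) (s₁ s₂ : E3) (σ σ' : ℤ → ℤ), IsHaggSeq σ ∧ IsHaggSeq σ' ∧
      L (EuclideanSpace.single (2 : Fin 3) (1 : ℝ)) = m' ∧
      P '' fccStacking 1 (Real.sqrt (2 / 3)) ⊆
        (fun q => L q + s₁) '' barlowStacking 1 (Real.sqrt (2 / 3)) σ ∧
      C '' fccStacking 1 (Real.sqrt (2 / 3)) ⊆
        (fun q => L q + s₂) '' barlowStacking 1 (Real.sqrt (2 / 3)) σ')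
    (hn : ‖n‖ = 1) (s : ℝ) :
    volume ({y : E3 | ∀ ν : E3, ⟪y, ν⟫_ℝ ≤ Real.sqrt 2 / 4 *
        ∑ᶠ w ∈ {w | w ∈ fccStacking 1 (Real.sqrt (2 / 3)) ∧ ‖w‖ = 1}, |⟪w, P.symm ν⟫_ℝ|} ∩
        {y : E3 | s + 1 / Real.sqrt 6 * Real.sqrt (1 - ⟪n, m'⟫_ℝ ^ 2) < ⟪y, n⟫_ℝ}) ≤
      volume ({y : E3 | ∀ ν : E3, ⟪y, ν⟫_ℝ ≤ Real.sqrt 2 / 4 *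
        ∑ᶠ w ∈ {w | w ∈ fccStacking 1 (Real.sqrt (2 / 3)) ∧ ‖w‖ = 1}, |⟪w, C.symm ν⟫_ℝ|} ∩
        {y : E3 | s < ⟪y, n⟫_ℝ}) := by
  have hn' : ‖-n‖ = 1 := by rw [norm_neg, hn]
  set θ : ℝ := 1 / Real.sqrt 6 * Real.sqrt (1 - ⟪n, m'⟫_ℝ ^ 2) with hθ
  -- TSS for the pair `(C, P)` along `−n` at the level `t = −s − θ`
  have h := cruxWulffBody_twin_cdf_le (cruxAx_symm h) (-n) hn' (-s - θ)
  have hθ' : 1 / Real.sqrt 6 * Real.sqrt (1 - ⟪-n, m'⟫_ℝ ^ 2) = θ := by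
    rw [hθ, inner_neg_left, neg_sq]
  rw [hθ'] at h
  have hP : {y : E3 | ⟪y, -n⟫_ℝ < -s - θ} = {y : E3 | s + θ < ⟪y, n⟫_ℝ} := by
    ext y; simp only [mem_setOf_eq, inner_neg_right]; constructor <;> intro hy <;> linarith
  have hC : {y : E3 | ⟪y, -n⟫_ℝ < -s - θ + θ} = {y : E3 | s < ⟪y, n⟫_ℝ} := by
    ext y; simp only [mem_setOf_eq, inner_neg_right]; constructor <;> intro hy <;> linarith
  rw [hP, hC] at h
  exact h

/-- **Cap shift `0` across a VERTICAL wall** (`Ax m' P C`, `⟪n, m'⟫ = 0`): equal profiles. -/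
theorem capShift_zero_of_perp {m' n : E3} {P C : E3 ≃ₗᵢ[ℝ] E3}
    (h : ∃ (L : E3 ≃ₗᵢ[ℝ] E3) (s₁ s₂ : E3) (σ σ' : ℤ → ℤ), IsHaggSeq σ ∧ IsHaggSeq σ' ∧
      L (EuclideanSpace.single (2 : Fin 3) (1 : ℝ)) = m' ∧
      P '' fccStacking 1 (Real.sqrt (2 / 3)) ⊆
        (fun q => L q + s₁) '' barlowStacking 1 (Real.sqrt (2 / 3)) σ ∧
      C '' fccStacking 1 (Real.sqrt (2 / 3)) ⊆
        (fun q => L q + s₂) '' barlowStacking 1 (Real.sqrt (2 / 3)) σ')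
    (hperp : ⟪n, m'⟫_ℝ = 0) (s : ℝ) :
    volume ({y : E3 | ∀ ν : E3, ⟪y, ν⟫_ℝ ≤ Real.sqrt 2 / 4 *
        ∑ᶠ w ∈ {w | w ∈ fccStacking 1 (Real.sqrt (2 / 3)) ∧ ‖w‖ = 1}, |⟪w, P.symm ν⟫_ℝ|} ∩
        {y : E3 | s + 0 < ⟪y, n⟫_ℝ}) ≤
      volume ({y : E3 | ∀ ν : E3, ⟪y, ν⟫_ℝ ≤ Real.sqrt 2 / 4 *
        ∑ᶠ w ∈ {w | w ∈ fccStacking 1 (Real.sqrt (2 / 3)) ∧ ‖w‖ = 1}, |⟪w, C.symm ν⟫_ℝ|} ∩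
        {y : E3 | s < ⟪y, n⟫_ℝ}) := by
  rw [add_zero]
  exact (volume_cruxWulffBody_inter_eq_of_perp h hperp s).symm.le

/-- **Cap shift `0` between EQUAL lattices** (`P''Λ = C''Λ`): equal bodies. -/
theorem capShift_zero_of_image_eq {n : E3} {P C : E3 ≃ₗᵢ[ℝ] E3}
    (h : P '' fccStacking 1 (Real.sqrt (2 / 3)) = C '' fccStacking 1 (Real.sqrt (2 / 3))) (s : ℝ) :
    volume ({y : E3 | ∀ ν : E3, ⟪y, ν⟫_ℝ ≤ Real.sqrt 2 / 4 *
        ∑ᶠ w ∈ {w | w ∈ fccStacking 1 (Real.sqrt (2 / 3)) ∧ ‖w‖ = 1}, |⟪w, P.symm ν⟫_ℝ|} ∩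
        {y : E3 | s + 0 < ⟪y, n⟫_ℝ}) ≤
      volume ({y : E3 | ∀ ν : E3, ⟪y, ν⟫_ℝ ≤ Real.sqrt 2 / 4 *
        ∑ᶠ w ∈ {w | w ∈ fccStacking 1 (Real.sqrt (2 / 3)) ∧ ‖w‖ = 1}, |⟪w, C.symm ν⟫_ℝ|} ∩
        {y : E3 | s < ⟪y, n⟫_ℝ}) := by
  rw [add_zero, wulffBody_eq_of_image_eq h]

/-- **Basal walls need no gap**: if the wall normal IS the pair's axis (`n = m'`), the co-axial shift
`(1/√6)·√(1 − ⟪n, m'⟫²)` vanishes. -/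
theorem capShift_zero_of_coaxial_self {n : E3} {P C : E3 ≃ₗᵢ[ℝ] E3}
    (h : ∃ (L : E3 ≃ₗᵢ[ℝ] E3) (s₁ s₂ : E3) (σ σ' : ℤ → ℤ), IsHaggSeq σ ∧ IsHaggSeq σ' ∧
      L (EuclideanSpace.single (2 : Fin 3) (1 : ℝ)) = n ∧
      P '' fccStacking 1 (Real.sqrt (2 / 3)) ⊆
        (fun q => L q + s₁) '' barlowStacking 1 (Real.sqrt (2 / 3)) σ ∧
      C '' fccStacking 1 (Real.sqrt (2 / 3)) ⊆
        (fun q => L q + s₂) '' barlowStacking 1 (Real.sqrt (2 / 3)) σ') (s : ℝ) :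
    volume ({y : E3 | ∀ ν : E3, ⟪y, ν⟫_ℝ ≤ Real.sqrt 2 / 4 *
        ∑ᶠ w ∈ {w | w ∈ fccStacking 1 (Real.sqrt (2 / 3)) ∧ ‖w‖ = 1}, |⟪w, P.symm ν⟫_ℝ|} ∩
        {y : E3 | s + 0 < ⟪y, n⟫_ℝ}) ≤
      volume ({y : E3 | ∀ ν : E3, ⟪y, ν⟫_ℝ ≤ Real.sqrt 2 / 4 *
        ∑ᶠ w ∈ {w | w ∈ fccStacking 1 (Real.sqrt (2 / 3)) ∧ ‖w‖ = 1}, |⟪w, C.symm ν⟫_ℝ|} ∩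
        {y : E3 | s < ⟪y, n⟫_ℝ}) := by
  have hn : ‖n‖ = 1 := by
    obtain ⟨L, -, -, -, -, -, -, hL, -, -⟩ := h
    rw [← hL, LinearIsometryEquiv.norm_map]
    simp
  have h1 := capShift_of_coaxial h hn s
  have hnn : ⟪n, n⟫_ℝ = 1 := by rw [real_inner_self_eq_norm_sq, hn, one_pow]
  rw [hnn, one_pow, sub_self, Real.sqrt_zero, mul_zero] at h1
  exact h1

end Summit.Ventures.Crystal3D.Theorems

end
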